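import Literature.NumberTheory.DiophantineGeometry.FunctionFieldResidues
import Literature.NumberTheory.DiophantineGeometry.FunctionFieldFundamentalEquality
import Literature.NumberTheory.DiophantineGeometry.FunctionFieldDivisorClasses
import HarnessLib

/-!
# The Euler characteristic `χ = #S + 2g - 2` in a finite extension of function fields
  (Corvaja–Zannier 2008, §2, the "cover" remark) and `χ ≥ 1` for independent `S`-units

Topic: `Literature/NumberTheory/DiophantineGeometry`. Sibling proof file towards the named fact
`Literature.NumberTheory.DiophantineGeometry.CorvajaZannier2008_cor23` (`FunctionFieldGCD.lean`).

P. Corvaja, U. Zannier, *Some cases of Vojta's conjecture on integral points over function fields*,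
J. Algebraic Geom. 17 (2008) 295–333 = arXiv:math/0512074, §2, p. 4: "We also make the following
simple but important remark: if we replace the curve by a cover of it, of degree `d`, then the new
heights will be multiplied by `d` while the new `χ` will be at least the old one multiplied by `d`.
(This follows at once from the Riemann-Hurwitz formula, taking into account the possible ramifications
in and out of `S`.)" and, in the proof of Cor. 2.3, p. 5: "`χ = 0` … then `#S = 2, g = 0` and
necessarily there is a relation `aʳbˢ = γ ∈ κ*` … because some function `aᵘbᵛ` has no zeros or poles."

* `card_add_genus_ge_mul_of_cover` — for function fields `F ⊇ F₀ ⊇ K` of characteristic `0` with all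
  places rational and `K` the full constant field of both, `d = [F : F₀]`, a finite set of places `S₀` of
  `F₀` and `S` = all places of `F` above `S₀`: `#S + 2g(F) - 2 ≥ d · (#S₀ + 2g(F₀) - 2)`.
  Proof: Riemann–Hurwitz for a non-constant `y ∈ F₀` in both fields (`finsum_diffOrd_eq`:
  `2g - 2 = Σ_P diffOrd_P(y)`), the local rule `diffOrd_P(y) + 1 = e(P|P₀) (diffOrd_{P₀}(y) + 1)`
  (`diffOrd_algebraMap_add_one`) and the fundamental equality `Σ_{P|P₀} e(P|P₀) = d`
  (`sum_ramification_mul_degree_eq`): `2g - 2 = d(2g₀ - 2) + Σ_{P₀} (d - #{P | P₀})` with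
  `#{P | P₀} ≤ d`, and `#S = Σ_{P₀ ∈ S₀} #{P | P₀}`.
* `three_le_card_of_indep` / `one_le_eulerChar_of_indep` — if `a, b ∈ F ∖ K` have all their zeros and
  poles in `S` and satisfy no relation `aʳ = λ bˢ` (`(r,s) ≠ (0,0)`, `λ ∈ K*`), then `#S ≥ 3`, hence
  `#S + 2g - 2 ≥ 1`: a non-constant function has a zero and a pole, so `#S ≥ 2`, and if `S = {P, Q}` then
  `a^{v_P(b)} b^{-v_P(a)}` has no zeros or poles, hence is constant (`ℒ(0) = K`).

Everything is proved; no named facts are introduced.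

## References

* P. Corvaja, U. Zannier, J. Algebraic Geom. 17 (2008), §2 (p. 4, remark on covers; proof of Cor. 2.3).
  [CorvajaZannier2007]
* H. Stichtenoth, *Algebraic Function Fields and Codes*, GTM 254 (2009), Thm. 3.1.11, Cor. 3.4.14,
  Thm. 3.5.1, Lemma 1.4.7. [Stichtenoth2009]
-/

noncomputable section

open scoped Classical IntermediateField
open Finset

namespace Literature.NumberTheory.DiophantineGeometry.AlgFunctionField

universe u v

variable {K : Type u} [Field K]

/-! ### Riemann–Hurwitz for a finite extension `F/F₀`: the Euler characteristic of a cover -/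

section cover

variable {F₀ : Type v} {F : Type v} [Field F₀] [Field F] [Algebra K F₀] [Algebra K F] [Algebra F₀ F]
  [IsScalarTower K F₀ F] [IsAlgFunctionField K F₀] [FiniteDimensional F₀ F] [IsAlgFunctionField K F]

-- The ramification index `e(P|P₀) = v_P(π_{P₀}) ≥ 1` is `PlaceOver.one_le_ord_algebraMap_uniformizer`
-- (`FunctionFieldConstantExtensionGenusProofs.lean`); it is used directly below.

variable [IsIntegrallyClosedIn K F₀] [IsIntegrallyClosedIn K F]

omit [IsIntegrallyClosedIn K F₀] [IsIntegrallyClosedIn K F] in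
/-- **The local Riemann–Hurwitz rule in a tower** (characteristic `0`, rational places): for `y ∈ F₀ ∖ K`
and a place `P` of `F` above `P₀`, `diffOrd_P(y) + 1 = e(P|P₀) · (diffOrd_{P₀}(y) + 1)` — at a finite place
`v_P(y - y(P)) = e · v_{P₀}(y - y(P₀))`, at a pole `v_P(y) = e · v_{P₀}(y)`.
[cite: Stichtenoth2009, Thm. 3.5.1, Cor. 3.4.14] -/
theorem diffOrd_algebraMap_add_one (hrat₀ : ∀ P₀ : PlaceOver K F₀, P₀.IsRational) (P : PlaceOver K F)
    {y : F₀} (hy : y ∉ Set.range (algebraMap K F₀)) :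
    P.diffOrd (algebraMap F₀ F y) + 1 =
      P.ord (algebraMap F₀ F ((P.restrict (K := K) (F := F₀)).uniformizer : F₀)) *
        ((P.restrict (K := K) (F := F₀)).diffOrd y + 1) := by
  set P₀ := P.restrict (K := K) (F := F₀) with hP₀
  set e := P.ord (algebraMap F₀ F (P₀.uniformizer : F₀)) with he
  have he1 : 1 ≤ e := P.one_le_ord_algebraMap_uniformizer (K := K) (F := F₀)
  have hy0 : y ≠ 0 := fun h ↦ hy ⟨0, by rw [h, map_zero]⟩
  by_cases hyO : y ∈ P₀.toValuationSubring
  · -- finite place: `y ≡ c (mod t₀)`, and then also `y ≡ c (mod t)` upstairs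
    set c := P₀.value y with hc
    have hc₀ : y - algebraMap K F₀ c ∈ P₀.ball 1 := (hrat₀ P₀).sub_value_mem hyO
    have hyc0 : y - algebraMap K F₀ c ≠ 0 := fun h ↦ hy ⟨c, (sub_eq_zero.1 h).symm⟩
    have hord₀ : 1 ≤ P₀.ord (y - algebraMap K F₀ c) := (P₀.mem_ball_iff_le_ord 1 hyc0).1 hc₀
    have hmap : algebraMap F₀ F y - algebraMap K F c = algebraMap F₀ F (y - algebraMap K F₀ c) := by
      rw [map_sub, ← IsScalarTower.algebraMap_apply]
    have hord : P.ord (algebraMap F₀ F y - algebraMap K F c) = e * P₀.ord (y - algebraMap K F₀ c) := by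
      rw [hmap, P.ord_algebraMap_eq_mul (K := K) (y - algebraMap K F₀ c)]
    have hmem : algebraMap F₀ F y - algebraMap K F c ∈ P.ball 1 := by
      have hne : algebraMap F₀ F y - algebraMap K F c ≠ 0 := by
        rw [hmap]; exact (map_ne_zero _).2 hyc0
      refine (P.mem_ball_iff_le_ord 1 hne).2 ?_
      rw [hord]; nlinarith
    rw [P.diffOrd_of_sub_algebraMap_mem hmem, P₀.diffOrd_of_sub_algebraMap_mem hc₀, hord]
    ring
  · -- pole
    have hyO' : algebraMap F₀ F y ∉ P.toValuationSubring := fun h ↦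
      hyO ((P.mem_restrict_iff (K := K) (F := F₀) y).2 h)
    rw [P.diffOrd_of_not_mem hyO', P₀.diffOrd_of_not_mem hyO, P.ord_algebraMap_eq_mul (K := K) y]
    ring

omit [IsIntegrallyClosedIn K F₀] [IsIntegrallyClosedIn K F] in
/-- The fibre of `restrict` over `P₀`, as a `Finset`, and the **fundamental equality** with all places
rational: `Σ_{P | P₀} e(P|P₀) = [F : F₀]`. [cite: Stichtenoth2009, Thm. 3.1.11] -/
theorem sum_ramification_eq_finrank (hrat₀ : ∀ P₀ : PlaceOver K F₀, P₀.IsRational)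
    (hrat : ∀ P : PlaceOver K F, P.IsRational) (P₀ : PlaceOver K F₀) :
    ∑ P ∈ (P₀.finite_setOf_restrict_eq (F' := F)).toFinset,
        P.ord (algebraMap F₀ F (P₀.uniformizer : F₀)) = (Module.finrank F₀ F : ℤ) := by
  have h := P₀.sum_ramification_mul_degree_eq (F' := F) (P₀.finite_setOf_restrict_eq (F' := F)).toFinset
    (fun P ↦ P₀.mem_toFinset_restrict_eq_iff P)
  rw [show (P₀.degree : ℤ) = 1 by exact_mod_cast hrat₀ P₀, mul_one] at h
  rw [← h]
  exact Finset.sum_congr rfl fun P _ ↦ by rw [show (P.degree : ℤ) = 1 by exact_mod_cast hrat P, mul_one]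

omit [IsIntegrallyClosedIn K F₀] [IsIntegrallyClosedIn K F] in
/-- The number of places above `P₀` is at most `[F : F₀]` (each `e(P|P₀) ≥ 1`). [cite: Stichtenoth2009, Cor. 3.1.12] -/
theorem card_fibre_le_finrank (hrat₀ : ∀ P₀ : PlaceOver K F₀, P₀.IsRational)
    (hrat : ∀ P : PlaceOver K F, P.IsRational) (P₀ : PlaceOver K F₀) :
    ((P₀.finite_setOf_restrict_eq (F' := F)).toFinset.card : ℤ) ≤ Module.finrank F₀ F := by
  rw [← sum_ramification_eq_finrank hrat₀ hrat P₀, Finset.card_eq_sum_ones, Nat.cast_sum]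
  refine Finset.sum_le_sum fun P hP ↦ ?_
  rw [Nat.cast_one]
  have := P.one_le_ord_algebraMap_uniformizer (K := K) (F := F₀)
  rwa [(P₀.mem_toFinset_restrict_eq_iff P).1 hP] at this

/-- **The Euler characteristic of a cover** (Corvaja–Zannier, §2, p. 4: "if we replace the curve by a
cover of it, of degree `d`, then … the new `χ` will be at least the old one multiplied by `d`"). Let
`F ⊇ F₀ ⊇ K` be algebraic function fields of characteristic `0` with all places rational and `K` the full
constant field of both (e.g. `K` algebraically closed), `d = [F : F₀]`, `S₀` a finite set of places of
`F₀` and `S` the set of places of `F` above `S₀`. Then `d · (#S₀ + 2g(F₀) - 2) ≤ #S + 2g(F) - 2`.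
(Riemann–Hurwitz: `2g - 2 = d(2g₀ - 2) + Σ_{P₀}(d - #{P|P₀})`, and `#S = Σ_{P₀∈S₀} #{P|P₀}` with
`#{P|P₀} ≤ d`.) [cite: CorvajaZannier2007, §2 (remark on covers, p. 4)] -/
theorem card_add_genus_ge_mul_of_cover [CharZero K] (hrat₀ : ∀ P₀ : PlaceOver K F₀, P₀.IsRational)
    (hrat : ∀ P : PlaceOver K F, P.IsRational) {y : F₀} (hy : y ∉ Set.range (algebraMap K F₀))
    (S₀ : Finset (PlaceOver K F₀)) (S : Finset (PlaceOver K F))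
    (hS : ∀ P : PlaceOver K F, P ∈ S ↔ P.restrict (K := K) (F := F₀) ∈ S₀) :
    (Module.finrank F₀ F : ℤ) * ((S₀.card : ℤ) + 2 * genus K F₀ - 2) ≤
      (S.card : ℤ) + 2 * genus K F - 2 := by
  set d : ℤ := (Module.finrank F₀ F : ℤ) with hd
  set y' : F := algebraMap F₀ F y with hy'
  have hy'K : y' ∉ Set.range (algebraMap K F) := by
    rintro ⟨c, hc⟩
    apply hy
    refine ⟨c, (algebraMap F₀ F).injective ?_⟩
    rw [← IsScalarTower.algebraMap_apply, hc]
  -- fibres of `restrict`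
  set fib : PlaceOver K F₀ → Finset (PlaceOver K F) := fun P₀ ↦ (P₀.finite_setOf_restrict_eq (F' := F)).toFinset
    with hfib
  have hmemfib : ∀ P₀ P, P ∈ fib P₀ ↔ P.restrict (K := K) (F := F₀) = P₀ := fun P₀ P ↦
    P₀.mem_toFinset_restrict_eq_iff P
  have hdisj : ∀ (T₀ : Finset (PlaceOver K F₀)),
      (T₀ : Set (PlaceOver K F₀)).PairwiseDisjoint fib := by
    intro T₀ P₀ _ Q₀ _ hne
    rw [Function.onFun, Finset.disjoint_left]
    intro P hP hQ
    exact hne (((hmemfib P₀ P).1 hP).symm.trans ((hmemfib Q₀ P).1 hQ))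
  have hsume : ∀ P₀ : PlaceOver K F₀, ∑ P ∈ fib P₀, P.ord (algebraMap F₀ F (P₀.uniformizer : F₀)) = d :=
    fun P₀ ↦ sum_ramification_eq_finrank hrat₀ hrat P₀
  have hcardfib : ∀ P₀, ((fib P₀).card : ℤ) ≤ d := fun P₀ ↦ card_fibre_le_finrank hrat₀ hrat P₀
  -- a finite set `T₀ ⊇ S₀` of places of `F₀` off which (and off whose fibres) `y` is unramified
  set R₀ : Finset (PlaceOver K F₀) := (differentialDivisor (dOf K y)).support with hR₀
  set R : Finset (PlaceOver K F) := (differentialDivisor (dOf K y')).support with hR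
  set T₀ : Finset (PlaceOver K F₀) := S₀ ∪ R₀ ∪ R.image (fun P ↦ P.restrict (K := K) (F := F₀)) with hT₀
  set T : Finset (PlaceOver K F) := T₀.biUnion fib with hT
  have hS₀T₀ : S₀ ⊆ T₀ := fun P₀ hP₀ ↦ by simp [hT₀, hP₀]
  have hδ₀ : ∀ P₀, P₀ ∉ T₀ → P₀.diffOrd y = 0 := by
    intro P₀ hP₀
    rw [← differentialDivisor_dOf_apply hrat₀ hy P₀]
    by_contra h
    exact hP₀ (by simp [hT₀, hR₀, Finsupp.mem_support_iff.2 h])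
  have hδ : ∀ P, P ∉ T → P.diffOrd y' = 0 := by
    intro P hP
    rw [← differentialDivisor_dOf_apply hrat hy'K P]
    by_contra h
    apply hP
    rw [hT, Finset.mem_biUnion]
    refine ⟨P.restrict (K := K) (F := F₀), ?_, (hmemfib _ P).2 rfl⟩
    simp only [hT₀, Finset.mem_union, Finset.mem_image]
    exact Or.inr ⟨P, Finsupp.mem_support_iff.2 h, rfl⟩
  -- Riemann–Hurwitz downstairs and upstairs, as sums over `T₀` and `T`
  have hRH₀ : ∑ P₀ ∈ T₀, P₀.diffOrd y = 2 * genus K F₀ - 2 := by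
    rw [← finsum_diffOrd_eq hrat₀ hy, finsum_eq_sum_of_support_subset _ (s := T₀)]
    intro P₀ hP₀; by_contra h; exact hP₀ (hδ₀ P₀ h)
  have hRH : ∑ P ∈ T, P.diffOrd y' = 2 * genus K F - 2 := by
    rw [← finsum_diffOrd_eq hrat hy'K, finsum_eq_sum_of_support_subset _ (s := T)]
    intro P hP; by_contra h; exact hP (hδ P h)
  -- the fibrewise count
  have hfibre : ∀ P₀, ∑ P ∈ fib P₀, P.diffOrd y' = d * (P₀.diffOrd y + 1) - (fib P₀).card := by
    intro P₀
    have h1 : ∀ P ∈ fib P₀, P.diffOrd y' =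
        P.ord (algebraMap F₀ F (P₀.uniformizer : F₀)) * (P₀.diffOrd y + 1) - 1 := by
      intro P hP
      have h := diffOrd_algebraMap_add_one (K := K) (F := F) hrat₀ P hy
      rw [(hmemfib P₀ P).1 hP, ← hy'] at h
      linarith
    rw [Finset.sum_congr rfl h1, Finset.sum_sub_distrib, ← Finset.sum_mul, hsume P₀, Finset.sum_const,
      nsmul_eq_mul, mul_one]
  have hsplit : ∑ P ∈ T, P.diffOrd y' = ∑ P₀ ∈ T₀, ∑ P ∈ fib P₀, P.diffOrd y' := by
    rw [hT, Finset.sum_biUnion (hdisj T₀)]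
  have hsplit' : ∑ P₀ ∈ T₀, ∑ P ∈ fib P₀, P.diffOrd y' =
      d * ∑ P₀ ∈ T₀, P₀.diffOrd y + ∑ P₀ ∈ T₀, (d - ((fib P₀).card : ℤ)) := by
    rw [Finset.sum_congr rfl fun P₀ _ ↦ hfibre P₀, Finset.mul_sum, ← Finset.sum_add_distrib]
    exact Finset.sum_congr rfl fun P₀ _ ↦ by ring
  -- `#S = Σ_{P₀ ∈ S₀} #{P | P₀}`
  have hScard : (S.card : ℤ) = ∑ P₀ ∈ S₀, ((fib P₀).card : ℤ) := by
    have hSeq : S = S₀.biUnion fib := by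
      ext P
      rw [hS, Finset.mem_biUnion]
      constructor
      · intro h; exact ⟨_, h, (hmemfib _ P).2 rfl⟩
      · rintro ⟨P₀, hP₀, hP⟩; rwa [(hmemfib P₀ P).1 hP]
    rw [hSeq, Finset.card_biUnion (hdisj S₀), Nat.cast_sum]
  -- conclusion
  have hsum_le : ∑ P₀ ∈ S₀, (d - ((fib P₀).card : ℤ)) ≤ ∑ P₀ ∈ T₀, (d - ((fib P₀).card : ℤ)) :=
    Finset.sum_le_sum_of_subset_of_nonneg hS₀T₀ fun P₀ _ _ ↦ by linarith [hcardfib P₀]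
  have hS₀sum : ∑ P₀ ∈ S₀, (d - ((fib P₀).card : ℤ)) = d * S₀.card - ∑ P₀ ∈ S₀, ((fib P₀).card : ℤ) := by
    rw [Finset.sum_sub_distrib, Finset.sum_const, nsmul_eq_mul, mul_comm]
  have hprod : d * ∑ P₀ ∈ T₀, P₀.diffOrd y = d * (2 * genus K F₀ - 2) := by rw [hRH₀]
  linarith [hRH, hsplit, hsplit', hScard, hsum_le, hS₀sum, hprod]

end cover

/-! ### `χ ≥ 1`: independent `S`-units need at least three places -/

section chi

variable {F : Type v} [Field F] [Algebra K F] [IsAlgFunctionField K F] [IsIntegrallyClosedIn K F]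

/-- A non-constant function has a pole. [cite: Stichtenoth2009, Cor. 1.1.20, Thm. 1.4.11] -/
theorem exists_ord_neg (hrat : ∀ P : PlaceOver K F, P.IsRational) {y : F}
    (hy : y ∉ Set.range (algebraMap K F)) : ∃ P : PlaceOver K F, P.ord y < 0 := by
  by_contra h
  push Not at h
  have hsum := sum_neg_ord_eq_finrank hrat hy ∅ (by simp) (fun P hP ↦ absurd hP (not_lt.2 (h P)))
  rw [Finset.sum_empty] at hsum
  haveI := IsAlgFunctionField.finiteDimensional_adjoin_simple (transcendental_of_not_mem_range hy)
  have : (0 : ℤ) < Module.finrank K⟮y⟯ F := by exact_mod_cast Module.finrank_pos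
  omega

/-- A non-constant function has a zero. [cite: Stichtenoth2009, Cor. 1.1.20, Thm. 1.4.11] -/
theorem exists_ord_pos (hrat : ∀ P : PlaceOver K F, P.IsRational) {y : F}
    (hy : y ∉ Set.range (algebraMap K F)) : ∃ P : PlaceOver K F, 0 < P.ord y := by
  have hy0 : y ≠ 0 := fun h ↦ hy ⟨0, by rw [h, map_zero]⟩
  have hyi : y⁻¹ ∉ Set.range (algebraMap K F) := by
    rintro ⟨c, hc⟩
    exact hy ⟨c⁻¹, by rw [map_inv₀, hc, inv_inv]⟩
  obtain ⟨P, hP⟩ := exists_ord_neg hrat hyi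
  rw [P.ord_inv hy0] at hP
  exact ⟨P, by omega⟩

/-- A function without zeros and poles is a non-zero constant (`ℒ(0) = K`). [cite: Stichtenoth2009, Lemma 1.4.7(a)] -/
theorem exists_eq_algebraMap_of_forall_ord_eq_zero {u : F} (hu : u ≠ 0) (h : ∀ P : PlaceOver K F, P.ord u = 0) :
    ∃ c : K, c ≠ 0 ∧ algebraMap K F c = u :=
  exists_eq_algebraMap_of_principalDivisor_eq_zero hu (Finsupp.ext fun P ↦ by
    rw [principalDivisor_apply_of_ne_zero hu, h P, Finsupp.coe_zero, Pi.zero_apply])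

/-- **At least three places** (proof of Cor. 2.3, p. 5: "if `#S = 2` … some function `aᵘbᵛ` has no
zeros or poles", hence is a non-zero constant, a multiplicative dependence). Let `a, b ∈ F ∖ K` have all
their zeros and poles in `S` and admit no relation `aʳ = λ bˢ`, `(r,s) ≠ (0,0)`, `λ ∈ K*`. Then `#S ≥ 3`.
[cite: CorvajaZannier2007, Cor. 2.3 (proof)] -/
theorem three_le_card_of_indep (hrat : ∀ P : PlaceOver K F, P.IsRational) (S : Finset (PlaceOver K F))
    {a b : F} (ha : a ∉ Set.range (algebraMap K F)) (hb : b ∉ Set.range (algebraMap K F))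
    (hunit : ∀ v : PlaceOver K F, v ∉ S → v.ord a = 0 ∧ v.ord b = 0)
    (hindep : ∀ (r s : ℤ) (c : K), (r, s) ≠ (0, 0) → c ≠ 0 → a ^ r ≠ algebraMap K F c * b ^ s) :
    3 ≤ S.card := by
  have ha0 : a ≠ 0 := fun h ↦ ha ⟨0, by rw [h, map_zero]⟩
  have hb0 : b ≠ 0 := fun h ↦ hb ⟨0, by rw [h, map_zero]⟩
  -- a pole `P` and a zero `Z` of `a`, both in `S`
  obtain ⟨P, hP⟩ := exists_ord_neg hrat ha
  obtain ⟨Z, hZ⟩ := exists_ord_pos hrat ha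
  have hPS : P ∈ S := by by_contra h; have := (hunit P h).1; omega
  have hZS : Z ∈ S := by by_contra h; have := (hunit Z h).1; omega
  have hPZ : P ≠ Z := fun h ↦ by rw [h] at hP; omega
  by_contra hlt
  push Not at hlt
  -- so `S = {P, Z}`
  have hSeq : S = {P, Z} := by
    symm
    apply Finset.eq_of_subset_of_card_le
    · intro x hx
      rcases Finset.mem_insert.1 hx with rfl | hx
      · exact hPS
      · rw [Finset.mem_singleton.1 hx]; exact hZS
    · rw [Finset.card_pair hPZ]; omega
  have hout : ∀ v : PlaceOver K F, v ≠ P → v ≠ Z → v.ord a = 0 ∧ v.ord b = 0 := fun v h1 h2 ↦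
    hunit v (by rw [hSeq]; simp [h1, h2])
  -- product formula on `S = {P, Z}`
  have hsum : ∀ {x : F}, x ≠ 0 → (∀ v : PlaceOver K F, v ≠ P → v ≠ Z → v.ord x = 0) →
      P.ord x + Z.ord x = 0 := by
    intro x hx0 hx
    have h := degree_principalDivisor_eq_zero (K := K) hx0
    rw [Divisor.degree_eq_finsum hrat, finsum_eq_sum_of_support_subset _ (s := {P, Z})] at h
    · rwa [Finset.sum_pair hPZ, principalDivisor_apply_of_ne_zero hx0, principalDivisor_apply_of_ne_zero hx0] at h
    · intro v hv
      rw [Function.mem_support, principalDivisor_apply_of_ne_zero hx0] at hv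
      by_contra h'
      simp only [Finset.coe_insert, Finset.coe_singleton, Set.mem_insert_iff, Set.mem_singleton_iff,
        not_or] at h'
      exact hv (hx v h'.1 h'.2)
  have hsa := hsum ha0 (fun v h1 h2 ↦ (hout v h1 h2).1)
  have hsb := hsum hb0 (fun v h1 h2 ↦ (hout v h1 h2).2)
  -- `v_P(b) ≠ 0`: otherwise `b` has no zeros or poles
  have hPb : P.ord b ≠ 0 := by
    intro h0
    obtain ⟨Q, hQ⟩ := exists_ord_neg hrat hb
    rcases eq_or_ne Q P with rfl | h1
    · omega
    rcases eq_or_ne Q Z with rfl | h2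
    · omega
    · have := (hout Q h1 h2).2; omega
  -- `u = a^{v_P(b)} b^{-v_P(a)}` has no zeros or poles
  set u : F := a ^ P.ord b * b ^ (-P.ord a) with hu
  have hu0 : u ≠ 0 := mul_ne_zero (zpow_ne_zero _ ha0) (zpow_ne_zero _ hb0)
  have hordu : ∀ v : PlaceOver K F, v.ord u = P.ord b * v.ord a - P.ord a * v.ord b := fun v ↦ by
    rw [hu, v.ord_mul_eq (zpow_ne_zero _ ha0) (zpow_ne_zero _ hb0), v.ord_zpow ha0, v.ord_zpow hb0]; ring
  have hu1 : ∀ v : PlaceOver K F, v.ord u = 0 := by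
    intro v
    rw [hordu]
    rcases eq_or_ne v P with rfl | h1
    · ring
    rcases eq_or_ne v Z with rfl | h2
    · have e1 : v.ord a = -P.ord a := by omega
      have e2 : v.ord b = -P.ord b := by omega
      rw [e1, e2]; ring
    · rw [(hout v h1 h2).1, (hout v h1 h2).2]; ring
  obtain ⟨c, hc0, hc⟩ := exists_eq_algebraMap_of_forall_ord_eq_zero hu0 hu1
  refine hindep (P.ord b) (P.ord a) c (fun h ↦ hPb (Prod.mk.inj h).1) hc0 ?_
  rw [hc, hu, mul_assoc, ← zpow_add₀ hb0, neg_add_cancel, zpow_zero, mul_one]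

/-- **`χ ≥ 1`** for two multiplicatively independent non-constant `S`-units: `1 ≤ #S + 2g - 2`.
[cite: CorvajaZannier2007, Cor. 2.3 (proof)] -/
theorem one_le_eulerChar_of_indep (hrat : ∀ P : PlaceOver K F, P.IsRational) (S : Finset (PlaceOver K F))
    {a b : F} (ha : a ∉ Set.range (algebraMap K F)) (hb : b ∉ Set.range (algebraMap K F))
    (hunit : ∀ v : PlaceOver K F, v ∉ S → v.ord a = 0 ∧ v.ord b = 0)
    (hindep : ∀ (r s : ℤ) (c : K), (r, s) ≠ (0, 0) → c ≠ 0 → a ^ r ≠ algebraMap K F c * b ^ s) :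
    (1 : ℤ) ≤ (S.card : ℤ) + 2 * genus K F - 2 := by
  have h3 : (3 : ℤ) ≤ S.card := by exact_mod_cast three_le_card_of_indep hrat S ha hb hunit hindep
  have hg : (0 : ℤ) ≤ genus K F := Int.natCast_nonneg _
  linarith

end chi

end Literature.NumberTheory.DiophantineGeometry.AlgFunctionField
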